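import Summits.ValiantsHypothesis.ValiantsHypothesis.Theorems.LacunarySymmetroidMatrixDescartesWLawArrowPivot
import Summits.ValiantsHypothesis.ValiantsHypothesis.Theorems.LacunarySymmetroidMatrixDescartesCensusPivotKit

/-!
# `MatrixDescartes` (stmt-ValiantsHypothesis-18050) — the `K = 4` PIVOT COLUMN AT ALL SIZES: the BALANCED ARROWHEAD
# LETTERS (positive semidefiniteness, the determinant at `x > 0`)

HONEST FRAMING.  Cell `pub-symmetroid`, seat `val-sym-mdr-p2` (gen 8); helper file `--supports` the crux
`Theses.LacunarySymmetroid.MatrixDescartes` (OPEN), NO closure claim.  Linear-algebra half of an all-sizes LOWER bound for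
conjb-1's pivot rows `Pivot.PivotRootLawAt m 4 1 B` (`…CensusPivotDefs`): `Z₊ ≥ 6m − 4` at `(m, K) = (m, 4)`, index one —
the budget of the typed bilinear guess `RankOnePivotLawBilinear` (`2(m−1)(K−1) + 2`) along `K = 4`.  The companion file
`…PivotArrowFour` assembles the theorem with the generic kit `…PivotArrowSixKit`.  Nothing here bears on `MatrixDescartes`
in its window, on `stub_twoSided`, `DoorA26` / `DoorA34`, the census registers, or `VP ≠ VNP`.

THE BLOCK (support `(e; below; above) = (3; 0, 2; 5, 19)`, data `(a₁, a₂, j, c₁, c₂) = (2/25, 27/20, 200, 17000, 1200)`):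
a BALANCED arrowhead block — the two sub-pivot letters bordered with ratio `+ω`, the two super-pivot letters with ratio `−ω`,
diagonal pivot entry `j > 0`, zero slacks — has Schur function `U·x³·φ₄(x/Ξ)` with
`φ₄(y) = y²(4(a₁ + a₂y²)(c₁ + c₂y¹⁴) − j²y)/(a₁ + a₂y² + jy³ + c₁y⁵ + c₂y¹⁹) = (4BA − j²y⁶)/(y³m)` (`block_identity`):
bounded, `→ 0` at both ends, and crossing the level `73/20` SIX times (`> 73/20` at `1/20, 3/5, 13/10`; `< 73/20` at
`3/10, 1, 10`) — an in-block «staircase» (the top exponent `19` is far out so that the top letter activates at the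
pole of the lower factor).  LETTERS (size `k+1`, index `Fin k ⊕ Fin 1`, scales `Ξᵢ`, amplitudes `Uᵢ`, slack `s`):
`P_a = [[diag(a₁Ξᵢ³⁵/Uᵢ), (a₁Ξᵢ¹⁹)ᵢ], [·ᵀ, ∑a₁UᵢΞᵢ³ + 1]]`, `P_b = [[diag(a₂Ξᵢ³³/Uᵢ), (a₂Ξᵢ¹⁷)ᵢ], [·ᵀ, ∑a₂UᵢΞᵢ]]`,
`Q_c = [[diag(c₁Ξᵢ³⁰/Uᵢ), (−c₁Ξᵢ¹⁴)ᵢ], [·ᵀ, ∑c₁Uᵢ/Ξᵢ²]]`, `Q_d = [[diag(c₂Ξᵢ¹⁶/Uᵢ), (−c₂)ᵢ], [·ᵀ, ∑c₂Uᵢ/Ξᵢ¹⁶ + s]]`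
(Schur complements `1, 0, 0, s` ⇒ PSD), `J = diag(jΞᵢ³²/Uᵢ, …, −1 − j∑Uᵢ)` (diagonal, one negative entry).
`det_pencil_eval`: `det(x³J + P_a + x²P_b + x⁵Q_c + x¹⁹Q_d) = (∏ᵢ mᵢ(x))·x³·(x⁻³ − 1 + ∑ᵢ Uᵢφ₄(x/Ξᵢ) + s x¹⁶)` at `x > 0`.

[folklore] Elementary linear algebra / real analysis over Mathlib; tree inputs `WLawArrow.posSemidef_arrow`,
`WLawArrow.det_arrow`, `Pivot.eval_det_pivot`.  Axioms `propext`, `Classical.choice`, `Quot.sound`.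
-/

set_option linter.dupNamespace false

namespace Summit.ValiantsHypothesis.ValiantsHypothesis.Theorems.LacunarySymmetroidMatrixDescartes

open scoped BigOperators Topology Matrix
open Filter Matrix Polynomial

namespace PivotArrowFour

/-- The reference block shape `φ₄` (local notation, no definition). -/
local notation3 (prettyPrint := false) "φ₄[" y "]" =>
  ((y : ℝ) ^ 2 * (4 * (2 / 25 + 27 / 20 * (y : ℝ) ^ 2) * (17000 + 1200 * (y : ℝ) ^ 14) - 40000 * (y : ℝ))
    / (2 / 25 + 27 / 20 * (y : ℝ) ^ 2 + 200 * (y : ℝ) ^ 3 + 17000 * (y : ℝ) ^ 5 + 1200 * (y : ℝ) ^ 19))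

/-- The scalar model `M₄(x) = x⁻³ − 1 + ∑ᵢ Uᵢ φ₄(x / Ξᵢ)` (local notation, no definition). -/
local notation3 (prettyPrint := false) "M₄[" Ξ ", " U "](" x ")" =>
  ((x : ℝ)⁻¹ ^ 3 - 1 + ∑ i, (U : Fin _ → ℝ) i * φ₄[(x : ℝ) / (Ξ : Fin _ → ℝ) i])

/-! ## The balanced arrowhead pencil: block form and determinant -/

/-- The pencil `x³ J + (P_a + x² P_b + x⁵ Q_c + x¹⁹ Q_d)` of the balanced arrowhead letters is the arrowhead matrix
with diagonal `mᵢ(x)`, border `gᵢ(x)` and corner `h(x)` (entrywise bookkeeping). [bookkeeping] -/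
theorem pencil_arrow_eq {k : ℕ} (Ξ U : Fin k → ℝ) (s x : ℝ) :
    x ^ 3 • Matrix.fromBlocks (diagonal fun i => 200 * Ξ i ^ 32 / U i) 0 0
        (Matrix.of fun (_ _ : Fin 1) => -1 - 200 * ∑ i, U i)
      + (x ^ 0 • Matrix.fromBlocks (diagonal fun i => 2 / 25 * Ξ i ^ 35 / U i)
          (Matrix.of fun (i : Fin k) (_ : Fin 1) => 2 / 25 * Ξ i ^ 19)
          (Matrix.of fun (_ : Fin 1) (i : Fin k) => 2 / 25 * Ξ i ^ 19)
          (Matrix.of fun (_ _ : Fin 1) => (∑ i, 2 / 25 * U i * Ξ i ^ 3) + 1)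
        + x ^ 2 • Matrix.fromBlocks (diagonal fun i => 27 / 20 * Ξ i ^ 33 / U i)
          (Matrix.of fun (i : Fin k) (_ : Fin 1) => 27 / 20 * Ξ i ^ 17)
          (Matrix.of fun (_ : Fin 1) (i : Fin k) => 27 / 20 * Ξ i ^ 17)
          (Matrix.of fun (_ _ : Fin 1) => ∑ i, 27 / 20 * U i * Ξ i)
        + x ^ 5 • Matrix.fromBlocks (diagonal fun i => 17000 * Ξ i ^ 30 / U i)
          (Matrix.of fun (i : Fin k) (_ : Fin 1) => -(17000 * Ξ i ^ 14))
          (Matrix.of fun (_ : Fin 1) (i : Fin k) => -(17000 * Ξ i ^ 14))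
          (Matrix.of fun (_ _ : Fin 1) => ∑ i, 17000 * U i / Ξ i ^ 2)
        + x ^ 19 • Matrix.fromBlocks (diagonal fun i => 1200 * Ξ i ^ 16 / U i)
          (Matrix.of fun (_ : Fin k) (_ : Fin 1) => -(1200 : ℝ))
          (Matrix.of fun (_ : Fin 1) (_ : Fin k) => -(1200 : ℝ))
          (Matrix.of fun (_ _ : Fin 1) => (∑ i, 1200 * U i / Ξ i ^ 16) + s))
    = Matrix.fromBlocks
        (diagonal fun i => (2 / 25 * Ξ i ^ 35 + 27 / 20 * Ξ i ^ 33 * x ^ 2 + 200 * Ξ i ^ 32 * x ^ 3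
          + 17000 * Ξ i ^ 30 * x ^ 5 + 1200 * Ξ i ^ 16 * x ^ 19) / U i)
        (Matrix.of fun (i : Fin k) (_ : Fin 1) =>
          2 / 25 * Ξ i ^ 19 + 27 / 20 * Ξ i ^ 17 * x ^ 2 - 17000 * Ξ i ^ 14 * x ^ 5 - 1200 * x ^ 19)
        (Matrix.of fun (_ : Fin 1) (i : Fin k) =>
          2 / 25 * Ξ i ^ 19 + 27 / 20 * Ξ i ^ 17 * x ^ 2 - 17000 * Ξ i ^ 14 * x ^ 5 - 1200 * x ^ 19)
        (Matrix.of fun (_ _ : Fin 1) =>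
          ((∑ i, 2 / 25 * U i * Ξ i ^ 3) + 1) + (∑ i, 27 / 20 * U i * Ξ i) * x ^ 2
            + (-1 - 200 * ∑ i, U i) * x ^ 3 + (∑ i, 17000 * U i / Ξ i ^ 2) * x ^ 5
            + ((∑ i, 1200 * U i / Ξ i ^ 16) + s) * x ^ 19) := by
  ext i j
  rcases i with i | i <;> rcases j with j | j
  · by_cases hij : i = j
    · subst hij
      simp only [Matrix.add_apply, Matrix.smul_apply, Matrix.fromBlocks_apply₁₁, diagonal_apply_eq, smul_eq_mul]
      ring
    · simp only [Matrix.add_apply, Matrix.smul_apply, Matrix.fromBlocks_apply₁₁, diagonal_apply_ne _ hij,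
        smul_eq_mul, mul_zero, add_zero]
  · simp only [Matrix.add_apply, Matrix.smul_apply, Matrix.fromBlocks_apply₁₂, Matrix.of_apply,
      Matrix.zero_apply, smul_eq_mul]
    ring
  · simp only [Matrix.add_apply, Matrix.smul_apply, Matrix.fromBlocks_apply₂₁, Matrix.of_apply,
      Matrix.zero_apply, smul_eq_mul]
    ring
  · simp only [Matrix.add_apply, Matrix.smul_apply, Matrix.fromBlocks_apply₂₂, Matrix.of_apply, smul_eq_mul]
    ring

/-- The diagonal entries `mᵢ(x)` are positive for `x ≥ 0`. [folklore] -/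
theorem m_pos {Ξi Ui x : ℝ} (hΞ : 0 < Ξi) (hU : 0 < Ui) (hx : 0 ≤ x) :
    0 < (2 / 25 * Ξi ^ 35 + 27 / 20 * Ξi ^ 33 * x ^ 2 + 200 * Ξi ^ 32 * x ^ 3 + 17000 * Ξi ^ 30 * x ^ 5
      + 1200 * Ξi ^ 16 * x ^ 19) / Ui := by
  positivity

/-- **One balanced block**: its share of the Schur complement is `Uᵢ x³ φ₄(x/Ξᵢ)`. [folklore] -/
theorem block_identity {Ξi Ui x : ℝ} (hΞ : 0 < Ξi) (hU : 0 < Ui) (hx : 0 ≤ x) :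
    2 / 25 * Ui * Ξi ^ 3 + 27 / 20 * Ui * Ξi * x ^ 2 - 200 * Ui * x ^ 3 + 17000 * Ui / Ξi ^ 2 * x ^ 5
        + 1200 * Ui / Ξi ^ 16 * x ^ 19
        - (2 / 25 * Ξi ^ 19 + 27 / 20 * Ξi ^ 17 * x ^ 2 - 17000 * Ξi ^ 14 * x ^ 5 - 1200 * x ^ 19) ^ 2
          / ((2 / 25 * Ξi ^ 35 + 27 / 20 * Ξi ^ 33 * x ^ 2 + 200 * Ξi ^ 32 * x ^ 3 + 17000 * Ξi ^ 30 * x ^ 5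
            + 1200 * Ξi ^ 16 * x ^ 19) / Ui)
      = Ui * x ^ 3 * φ₄[x / Ξi] := by
  have hD : 0 < 2 / 25 * Ξi ^ 19 + 27 / 20 * Ξi ^ 17 * x ^ 2 + 200 * Ξi ^ 16 * x ^ 3 + 17000 * Ξi ^ 14 * x ^ 5
      + 1200 * x ^ 19 := by positivity
  have hden : 0 < 2 / 25 + 27 / 20 * (x / Ξi) ^ 2 + 200 * (x / Ξi) ^ 3 + 17000 * (x / Ξi) ^ 5
      + 1200 * (x / Ξi) ^ 19 := by positivity
  have key : φ₄[x / Ξi] = x ^ 2 * (4 * Ξi * (2 / 25 * Ξi ^ 2 + 27 / 20 * x ^ 2) * (17000 * Ξi ^ 14 + 1200 * x ^ 14)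
      - 40000 * Ξi ^ 16 * x) / (2 / 25 * Ξi ^ 19 + 27 / 20 * Ξi ^ 17 * x ^ 2 + 200 * Ξi ^ 16 * x ^ 3
        + 17000 * Ξi ^ 14 * x ^ 5 + 1200 * x ^ 19) := by
    rw [div_eq_div_iff hden.ne' hD.ne']
    field_simp
  have hm : (2 / 25 * Ξi ^ 35 + 27 / 20 * Ξi ^ 33 * x ^ 2 + 200 * Ξi ^ 32 * x ^ 3 + 17000 * Ξi ^ 30 * x ^ 5
        + 1200 * Ξi ^ 16 * x ^ 19) / Ui
      = Ξi ^ 16 * (2 / 25 * Ξi ^ 19 + 27 / 20 * Ξi ^ 17 * x ^ 2 + 200 * Ξi ^ 16 * x ^ 3 + 17000 * Ξi ^ 14 * x ^ 5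
        + 1200 * x ^ 19) / Ui := by ring
  rw [key, hm]
  field_simp
  ring

/-- **The Schur complement of the balanced arrowhead pencil is `x³ · (model + s x¹⁶)`** (`x > 0`). [folklore] -/
theorem schur_eq {k : ℕ} (Ξ U : Fin k → ℝ) (hΞ : ∀ i, 0 < Ξ i) (hU : ∀ i, 0 < U i) (s : ℝ) {x : ℝ}
    (hx : 0 < x) :
    (((∑ i, 2 / 25 * U i * Ξ i ^ 3) + 1) + (∑ i, 27 / 20 * U i * Ξ i) * x ^ 2
        + (-1 - 200 * ∑ i, U i) * x ^ 3 + (∑ i, 17000 * U i / Ξ i ^ 2) * x ^ 5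
        + ((∑ i, 1200 * U i / Ξ i ^ 16) + s) * x ^ 19)
        - ∑ i, (2 / 25 * Ξ i ^ 19 + 27 / 20 * Ξ i ^ 17 * x ^ 2 - 17000 * Ξ i ^ 14 * x ^ 5 - 1200 * x ^ 19) ^ 2
            / ((2 / 25 * Ξ i ^ 35 + 27 / 20 * Ξ i ^ 33 * x ^ 2 + 200 * Ξ i ^ 32 * x ^ 3 + 17000 * Ξ i ^ 30 * x ^ 5
              + 1200 * Ξ i ^ 16 * x ^ 19) / U i)
      = x ^ 3 * (M₄[Ξ, U](x) + s * x ^ 16) := by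
  have hblocks : ∑ i, U i * φ₄[x / Ξ i] * x ^ 3
      = ∑ i, (2 / 25 * U i * Ξ i ^ 3 + 27 / 20 * U i * Ξ i * x ^ 2 - 200 * U i * x ^ 3
        + 17000 * U i / Ξ i ^ 2 * x ^ 5 + 1200 * U i / Ξ i ^ 16 * x ^ 19
        - (2 / 25 * Ξ i ^ 19 + 27 / 20 * Ξ i ^ 17 * x ^ 2 - 17000 * Ξ i ^ 14 * x ^ 5 - 1200 * x ^ 19) ^ 2
          / ((2 / 25 * Ξ i ^ 35 + 27 / 20 * Ξ i ^ 33 * x ^ 2 + 200 * Ξ i ^ 32 * x ^ 3 + 17000 * Ξ i ^ 30 * x ^ 5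
            + 1200 * Ξ i ^ 16 * x ^ 19) / U i)) := by
    refine Finset.sum_congr rfl fun i _ => ?_
    rw [block_identity (hΞ i) (hU i) hx.le]
    ring
  have hx3 : x⁻¹ ^ 3 * x ^ 3 = 1 := by
    rw [← mul_pow, inv_mul_cancel₀ hx.ne', one_pow]
  have hR : ∑ i, (2 / 25 * U i * Ξ i ^ 3 + 27 / 20 * U i * Ξ i * x ^ 2 - 200 * U i * x ^ 3
        + 17000 * U i / Ξ i ^ 2 * x ^ 5 + 1200 * U i / Ξ i ^ 16 * x ^ 19
        - (2 / 25 * Ξ i ^ 19 + 27 / 20 * Ξ i ^ 17 * x ^ 2 - 17000 * Ξ i ^ 14 * x ^ 5 - 1200 * x ^ 19) ^ 2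
          / ((2 / 25 * Ξ i ^ 35 + 27 / 20 * Ξ i ^ 33 * x ^ 2 + 200 * Ξ i ^ 32 * x ^ 3 + 17000 * Ξ i ^ 30 * x ^ 5
            + 1200 * Ξ i ^ 16 * x ^ 19) / U i))
      = (∑ i, 2 / 25 * U i * Ξ i ^ 3) + (∑ i, 27 / 20 * U i * Ξ i) * x ^ 2 - (200 * ∑ i, U i) * x ^ 3
        + (∑ i, 17000 * U i / Ξ i ^ 2) * x ^ 5 + (∑ i, 1200 * U i / Ξ i ^ 16) * x ^ 19
        - ∑ i, (2 / 25 * Ξ i ^ 19 + 27 / 20 * Ξ i ^ 17 * x ^ 2 - 17000 * Ξ i ^ 14 * x ^ 5 - 1200 * x ^ 19) ^ 2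
          / ((2 / 25 * Ξ i ^ 35 + 27 / 20 * Ξ i ^ 33 * x ^ 2 + 200 * Ξ i ^ 32 * x ^ 3 + 17000 * Ξ i ^ 30 * x ^ 5
            + 1200 * Ξ i ^ 16 * x ^ 19) / U i) := by
    rw [Finset.sum_sub_distrib, Finset.sum_add_distrib, Finset.sum_add_distrib, Finset.sum_sub_distrib,
      Finset.sum_add_distrib, Finset.mul_sum, Finset.sum_mul, Finset.sum_mul, Finset.sum_mul, Finset.sum_mul]
  calc _ = (1 - x ^ 3 + s * x ^ 19) + ∑ i, (2 / 25 * U i * Ξ i ^ 3 + 27 / 20 * U i * Ξ i * x ^ 2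
        - 200 * U i * x ^ 3 + 17000 * U i / Ξ i ^ 2 * x ^ 5 + 1200 * U i / Ξ i ^ 16 * x ^ 19
        - (2 / 25 * Ξ i ^ 19 + 27 / 20 * Ξ i ^ 17 * x ^ 2 - 17000 * Ξ i ^ 14 * x ^ 5 - 1200 * x ^ 19) ^ 2
          / ((2 / 25 * Ξ i ^ 35 + 27 / 20 * Ξ i ^ 33 * x ^ 2 + 200 * Ξ i ^ 32 * x ^ 3 + 17000 * Ξ i ^ 30 * x ^ 5
            + 1200 * Ξ i ^ 16 * x ^ 19) / U i)) := by
          rw [hR]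
          ring
    _ = (1 - x ^ 3 + s * x ^ 19) + ∑ i, U i * φ₄[x / Ξ i] * x ^ 3 := by rw [hblocks]
    _ = x ^ 3 * (M₄[Ξ, U](x) + s * x ^ 16) := by
          rw [← Finset.sum_mul]
          linear_combination (-1 : ℝ) * hx3

/-! ## The letters in `Fin (k+1)` format, positive semidefiniteness, and the determinant at `x > 0` -/

/-- Letter `P_a` (exponent `0`; local notation, no definition). -/
local notation3 (prettyPrint := false) "Pa[" Ξ ", " U "]" =>
  Matrix.fromBlocks (diagonal fun i => 2 / 25 * (Ξ : Fin _ → ℝ) i ^ 35 / (U : Fin _ → ℝ) i)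
    (Matrix.of fun (i : Fin _) (_ : Fin 1) => 2 / 25 * (Ξ : Fin _ → ℝ) i ^ 19)
    (Matrix.of fun (_ : Fin 1) (i : Fin _) => 2 / 25 * (Ξ : Fin _ → ℝ) i ^ 19)
    (Matrix.of fun (_ _ : Fin 1) => (∑ i, 2 / 25 * (U : Fin _ → ℝ) i * (Ξ : Fin _ → ℝ) i ^ 3) + 1)

/-- Letter `P_b` (exponent `2`; local notation, no definition). -/
local notation3 (prettyPrint := false) "Pb[" Ξ ", " U "]" =>
  Matrix.fromBlocks (diagonal fun i => 27 / 20 * (Ξ : Fin _ → ℝ) i ^ 33 / (U : Fin _ → ℝ) i)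
    (Matrix.of fun (i : Fin _) (_ : Fin 1) => 27 / 20 * (Ξ : Fin _ → ℝ) i ^ 17)
    (Matrix.of fun (_ : Fin 1) (i : Fin _) => 27 / 20 * (Ξ : Fin _ → ℝ) i ^ 17)
    (Matrix.of fun (_ _ : Fin 1) => ∑ i, 27 / 20 * (U : Fin _ → ℝ) i * (Ξ : Fin _ → ℝ) i)

/-- The pivot letter `J` (exponent `3`; diagonal; local notation, no definition). -/
local notation3 (prettyPrint := false) "J4[" Ξ ", " U "]" =>
  Matrix.fromBlocks (diagonal fun i => 200 * (Ξ : Fin _ → ℝ) i ^ 32 / (U : Fin _ → ℝ) i) 0 0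
    (Matrix.of fun (_ _ : Fin 1) => -1 - 200 * ∑ i, (U : Fin _ → ℝ) i)

/-- Letter `Q_c` (exponent `5`; local notation, no definition). -/
local notation3 (prettyPrint := false) "Qc[" Ξ ", " U "]" =>
  Matrix.fromBlocks (diagonal fun i => 17000 * (Ξ : Fin _ → ℝ) i ^ 30 / (U : Fin _ → ℝ) i)
    (Matrix.of fun (i : Fin _) (_ : Fin 1) => -(17000 * (Ξ : Fin _ → ℝ) i ^ 14))
    (Matrix.of fun (_ : Fin 1) (i : Fin _) => -(17000 * (Ξ : Fin _ → ℝ) i ^ 14))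
    (Matrix.of fun (_ _ : Fin 1) => ∑ i, 17000 * (U : Fin _ → ℝ) i / (Ξ : Fin _ → ℝ) i ^ 2)

/-- Letter `Q_d` (exponent `19`; carries the slack `s`; local notation, no definition). -/
local notation3 (prettyPrint := false) "Qd[" Ξ ", " U ", " s "]" =>
  Matrix.fromBlocks (diagonal fun i => 1200 * (Ξ : Fin _ → ℝ) i ^ 16 / (U : Fin _ → ℝ) i)
    (Matrix.of fun (_ : Fin _) (_ : Fin 1) => -(1200 : ℝ))
    (Matrix.of fun (_ : Fin 1) (_ : Fin _) => -(1200 : ℝ))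
    (Matrix.of fun (_ _ : Fin 1) => (∑ i, 1200 * (U : Fin _ → ℝ) i / (Ξ : Fin _ → ℝ) i ^ 16) + (s : ℝ))

/-- Reindexing `Fin k ⊕ Fin 1 ≃ Fin (k + 1)` (local notation). -/
local notation3 (prettyPrint := false) "rx[" A "]" => Matrix.reindex finSumFinEquiv finSumFinEquiv A

/-- The four PSD letters as a `Fin 4`-family (local notation). -/
local notation3 (prettyPrint := false) "P4[" Ξ ", " U ", " s "]" =>
  (![rx[Pa[Ξ, U]], rx[Pb[Ξ, U]], rx[Qc[Ξ, U]], rx[Qd[Ξ, U, s]]] : Fin 4 → Matrix (Fin (_ + 1)) (Fin (_ + 1)) ℝ)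

/-- The pencil of reindexed letters is the reindexed pencil. [bookkeeping] -/
theorem reindex_pencil {k : ℕ} (J A B C D : Matrix (Fin k ⊕ Fin 1) (Fin k ⊕ Fin 1) ℝ) (x : ℝ) :
    x ^ 3 • rx[J] + (x ^ 0 • rx[A] + x ^ 2 • rx[B] + x ^ 5 • rx[C] + x ^ 19 • rx[D])
      = rx[x ^ 3 • J + (x ^ 0 • A + x ^ 2 • B + x ^ 5 • C + x ^ 19 • D)] := by
  ext i j
  simp [Matrix.reindex_apply]

/-- `J` is symmetric. [bookkeeping] -/
theorem isSymm_J {k : ℕ} (Ξ U : Fin k → ℝ) : (rx[J4[Ξ, U]]).IsSymm := by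
  rw [Matrix.reindex_apply]
  refine Matrix.IsSymm.submatrix ?_ _
  refine Matrix.IsSymm.fromBlocks (isSymm_diagonal _) (by simp) ?_
  ext i j; fin_cases i; fin_cases j; rfl

/-- **The pivot letter has index one**: `J + W Wᵀ ⪰ 0` for the column `W = (0, …, 0, √(1 + 200∑Uᵢ))ᵀ`.
[folklore] -/
theorem indexOne_J {k : ℕ} (Ξ U : Fin k → ℝ) (hU : ∀ i, 0 < U i) :
    ∃ W : Matrix (Fin (k + 1)) (Fin 1) ℝ, (rx[J4[Ξ, U]] + W * Wᵀ).PosSemidef := by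
  set c : ℝ := 1 + 200 * ∑ i, U i with hc
  have hc0 : 0 ≤ c := by
    rw [hc]
    have : 0 ≤ ∑ i, U i := Finset.sum_nonneg fun i _ => (hU i).le
    linarith
  set W₀ : Matrix (Fin k ⊕ Fin 1) (Fin 1) ℝ := Matrix.of (Sum.elim (fun _ _ => (0 : ℝ)) fun _ _ => Real.sqrt c)
    with hW₀
  refine ⟨W₀.submatrix finSumFinEquiv.symm (Equiv.refl (Fin 1)), ?_⟩
  have hblock : J4[Ξ, U] + W₀ * W₀ᵀ
      = Matrix.fromBlocks (diagonal fun i => 200 * Ξ i ^ 32 / U i) 0 0 (0 : Matrix (Fin 1) (Fin 1) ℝ) := by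
    ext i j
    rcases i with i | i <;> rcases j with j | j
    · simp [hW₀, Matrix.mul_apply, Matrix.fromBlocks]
    · simp [hW₀, Matrix.mul_apply, Matrix.fromBlocks]
    · simp [hW₀, Matrix.mul_apply, Matrix.fromBlocks]
    · simp only [hW₀, Matrix.add_apply, Matrix.fromBlocks_apply₂₂, Matrix.of_apply, Matrix.mul_apply,
        Matrix.transpose_apply, Sum.elim_inr, Finset.sum_const, Finset.card_univ, Fintype.card_fin,
        nsmul_eq_mul, Nat.cast_one, one_mul, Matrix.zero_apply]
      rw [Real.mul_self_sqrt hc0, hc]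
      ring
  have hrx : rx[J4[Ξ, U]] + W₀.submatrix finSumFinEquiv.symm (Equiv.refl (Fin 1))
        * (W₀.submatrix finSumFinEquiv.symm (Equiv.refl (Fin 1)))ᵀ
      = rx[J4[Ξ, U] + W₀ * W₀ᵀ] := by
    rw [Matrix.transpose_submatrix, Matrix.reindex_apply, Matrix.reindex_apply, Matrix.submatrix_add]
    congr 1
  rw [hrx, hblock, Matrix.reindex_apply]
  refine Matrix.PosSemidef.submatrix ?_ _
  refine posSemidef_fromBlocks_zero (posSemidef_diagonal_iff.2 fun i => ?_) Matrix.PosSemidef.zero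
  have := hU i
  positivity

/-- `P_a ⪰ 0` (Schur complement `1`). [folklore] -/
theorem posSemidef_Pa {k : ℕ} (Ξ U : Fin k → ℝ) (hΞ : ∀ i, 0 < Ξ i) (hU : ∀ i, 0 < U i) :
    (rx[Pa[Ξ, U]]).PosSemidef := by
  rw [Matrix.reindex_apply]
  refine Matrix.PosSemidef.submatrix ?_ _
  refine WLawArrow.posSemidef_arrow _ _ _ (fun i => by have := hΞ i; have := hU i; positivity) ?_
  have : ∑ i, (2 / 25 * Ξ i ^ 19) ^ 2 / (2 / 25 * Ξ i ^ 35 / U i) = ∑ i, 2 / 25 * U i * Ξ i ^ 3 := by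
    refine Finset.sum_congr rfl fun i _ => ?_
    have h1 := (hΞ i).ne'
    have h2 := (hU i).ne'
    field_simp
  rw [this]
  linarith

/-- `P_b ⪰ 0` (Schur complement `0`). [folklore] -/
theorem posSemidef_Pb {k : ℕ} (Ξ U : Fin k → ℝ) (hΞ : ∀ i, 0 < Ξ i) (hU : ∀ i, 0 < U i) :
    (rx[Pb[Ξ, U]]).PosSemidef := by
  rw [Matrix.reindex_apply]
  refine Matrix.PosSemidef.submatrix ?_ _
  refine WLawArrow.posSemidef_arrow _ _ _ (fun i => by have := hΞ i; have := hU i; positivity) (le_of_eq ?_)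
  refine Finset.sum_congr rfl fun i _ => ?_
  have h1 := (hΞ i).ne'
  have h2 := (hU i).ne'
  field_simp

/-- `Q_c ⪰ 0` (Schur complement `0`). [folklore] -/
theorem posSemidef_Qc {k : ℕ} (Ξ U : Fin k → ℝ) (hΞ : ∀ i, 0 < Ξ i) (hU : ∀ i, 0 < U i) :
    (rx[Qc[Ξ, U]]).PosSemidef := by
  rw [Matrix.reindex_apply]
  refine Matrix.PosSemidef.submatrix ?_ _
  refine WLawArrow.posSemidef_arrow _ _ _ (fun i => by have := hΞ i; have := hU i; positivity) (le_of_eq ?_)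
  refine Finset.sum_congr rfl fun i _ => ?_
  have h1 := (hΞ i).ne'
  have h2 := (hU i).ne'
  field_simp

/-- `Q_d ⪰ 0` (Schur complement `s ≥ 0`). [folklore] -/
theorem posSemidef_Qd {k : ℕ} (Ξ U : Fin k → ℝ) (hΞ : ∀ i, 0 < Ξ i) (hU : ∀ i, 0 < U i) {s : ℝ}
    (hs : 0 ≤ s) : (rx[Qd[Ξ, U, s]]).PosSemidef := by
  rw [Matrix.reindex_apply]
  refine Matrix.PosSemidef.submatrix ?_ _
  refine WLawArrow.posSemidef_arrow _ (fun _ => -(1200 : ℝ)) _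
    (fun i => by have := hΞ i; have := hU i; positivity) ?_
  have : ∑ i, (-(1200 : ℝ)) ^ 2 / (1200 * Ξ i ^ 16 / U i) = ∑ i, 1200 * U i / Ξ i ^ 16 := by
    refine Finset.sum_congr rfl fun i _ => ?_
    have h1 := (hΞ i).ne'
    have h2 := (hU i).ne'
    field_simp
  rw [this]
  linarith

/-- All four letters are positive semidefinite (as a `Fin 4`-family). [bookkeeping] -/
theorem posSemidef_letters {k : ℕ} (Ξ U : Fin k → ℝ) (hΞ : ∀ i, 0 < Ξ i) (hU : ∀ i, 0 < U i) {s : ℝ}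
    (hs : 0 ≤ s) : ∀ l : Fin 4, (P4[Ξ, U, s] l).PosSemidef := by
  intro l
  fin_cases l
  · simpa using posSemidef_Pa Ξ U hΞ hU
  · simpa using posSemidef_Pb Ξ U hΞ hU
  · simpa using posSemidef_Qc Ξ U hΞ hU
  · simpa using posSemidef_Qd Ξ U hΞ hU hs

/-- **The determinant of the balanced arrowhead pivot pencil at `x > 0`** is
`(∏ᵢ mᵢ(x)) · x³ · (M₄(x) + s x¹⁶)` with `mᵢ(x) > 0`. [folklore] -/
theorem det_pencil_eval {k : ℕ} (Ξ U : Fin k → ℝ) (hΞ : ∀ i, 0 < Ξ i) (hU : ∀ i, 0 < U i) (s : ℝ)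
    {x : ℝ} (hx : 0 < x) :
    (Matrix.det (((X : ℝ[X]) ^ 3) • (rx[J4[Ξ, U]]).map Polynomial.C
        + ∑ l, ((X : ℝ[X]) ^ (![0, 2, 5, 19] : Fin 4 → ℕ) l) • (P4[Ξ, U, s] l).map Polynomial.C)).eval x
      = (∏ i, (2 / 25 * Ξ i ^ 35 + 27 / 20 * Ξ i ^ 33 * x ^ 2 + 200 * Ξ i ^ 32 * x ^ 3 + 17000 * Ξ i ^ 30 * x ^ 5
          + 1200 * Ξ i ^ 16 * x ^ 19) / U i) * (x ^ 3 * (M₄[Ξ, U](x) + s * x ^ 16)) := by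
  rw [Pivot.eval_det_pivot]
  simp only [Fin.sum_univ_four, Matrix.cons_val_zero, Matrix.cons_val_one, Matrix.cons_val_two,
    Matrix.cons_val_three, Matrix.head_cons, Matrix.tail_cons]
  rw [reindex_pencil, Matrix.det_reindex_self, pencil_arrow_eq,
    WLawArrow.det_arrow _ _ _ (fun i => (m_pos (hΞ i) (hU i) hx.le).ne'), schur_eq Ξ U hΞ hU s hx]

/-- Hence, at positive points, opposite signs of `M₄ + s x¹⁶` give a negative product of the determinant values.
[bookkeeping] -/
theorem eval_mul_eval_neg {k : ℕ} (Ξ U : Fin k → ℝ) (hΞ : ∀ i, 0 < Ξ i) (hU : ∀ i, 0 < U i) (s : ℝ)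
    {x y : ℝ} (hx : 0 < x) (hy : 0 < y)
    (hneg : (M₄[Ξ, U](x) + s * x ^ 16) * (M₄[Ξ, U](y) + s * y ^ 16) < 0) :
    (Matrix.det (((X : ℝ[X]) ^ 3) • (rx[J4[Ξ, U]]).map Polynomial.C
        + ∑ l, ((X : ℝ[X]) ^ (![0, 2, 5, 19] : Fin 4 → ℕ) l) • (P4[Ξ, U, s] l).map Polynomial.C)).eval x
      * (Matrix.det (((X : ℝ[X]) ^ 3) • (rx[J4[Ξ, U]]).map Polynomial.C
        + ∑ l, ((X : ℝ[X]) ^ (![0, 2, 5, 19] : Fin 4 → ℕ) l) • (P4[Ξ, U, s] l).map Polynomial.C)).eval y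
      < 0 := by
  rw [det_pencil_eval Ξ U hΞ hU s hx, det_pencil_eval Ξ U hΞ hU s hy]
  have hc : 0 < (∏ i, (2 / 25 * Ξ i ^ 35 + 27 / 20 * Ξ i ^ 33 * x ^ 2 + 200 * Ξ i ^ 32 * x ^ 3
      + 17000 * Ξ i ^ 30 * x ^ 5 + 1200 * Ξ i ^ 16 * x ^ 19) / U i) * x ^ 3 :=
    mul_pos (Finset.prod_pos fun i _ => m_pos (hΞ i) (hU i) hx.le) (pow_pos hx 3)
  have hd : 0 < (∏ i, (2 / 25 * Ξ i ^ 35 + 27 / 20 * Ξ i ^ 33 * y ^ 2 + 200 * Ξ i ^ 32 * y ^ 3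
      + 17000 * Ξ i ^ 30 * y ^ 5 + 1200 * Ξ i ^ 16 * y ^ 19) / U i) * y ^ 3 :=
    mul_pos (Finset.prod_pos fun i _ => m_pos (hΞ i) (hU i) hy.le) (pow_pos hy 3)
  set A := M₄[Ξ, U](x) + s * x ^ 16 with hA
  set B := M₄[Ξ, U](y) + s * y ^ 16 with hB
  set c := (∏ i, (2 / 25 * Ξ i ^ 35 + 27 / 20 * Ξ i ^ 33 * x ^ 2 + 200 * Ξ i ^ 32 * x ^ 3
      + 17000 * Ξ i ^ 30 * x ^ 5 + 1200 * Ξ i ^ 16 * x ^ 19) / U i) with hcdef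
  set d := (∏ i, (2 / 25 * Ξ i ^ 35 + 27 / 20 * Ξ i ^ 33 * y ^ 2 + 200 * Ξ i ^ 32 * y ^ 3
      + 17000 * Ξ i ^ 30 * y ^ 5 + 1200 * Ξ i ^ 16 * y ^ 19) / U i) with hddef
  have : c * (x ^ 3 * A) * (d * (y ^ 3 * B)) = (c * x ^ 3) * (d * y ^ 3) * (A * B) := by ring
  rw [this]
  exact mul_neg_of_pos_of_neg (mul_pos hc hd) hneg

end PivotArrowFour

end Summit.ValiantsHypothesis.ValiantsHypothesis.Theorems.LacunarySymmetroidMatrixDescartes
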